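import Literature.MathematicalPhysics.StatisticalMechanics.NJLTwoPointTransferOperatorClustering
import HarnessLib

/-!
# The mass parity `m ↦ -m`, `σ ↦ -σ` of the complex spin systems, and Erratum (5) for all real `m ≠ 0`
# (Salmhofer–Seiler, CMP 139 (1991), §4 p. 420 "without loss of generality `m ≥ 0`"; Erratum (5))

Salmhofer–Seiler, p. 420 (before Remark 4.5): "Let `N ∈ ℕ`, and `⟨·⟩_Λ` denote the expectation
value of the `U(N)` model on `Λ` … Without loss of generality, `m ≥ 0`."  The reduction is the
spin flip `σ_x ↦ -σ_x`: the site weight `F(σ) = ∑_j (2Nm)^j σ^j/j!` (the tree's truncated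
`e^{2Nmσ}`, Def. 3.1 / Remark 3.2) goes to the one at `-m`, the bond weights `B(σ_xσ_y)` are even,
and the coefficient extraction `[·]_Λ = coeff_{∏σ_x^N}` picks up the sign `(-1)^{N|Λ|}`, which
cancels in `⟨·⟩_Λ = [·]_Λ/[1]_Λ`.  The Erratum's (5) is printed for "real `m ≠ 0`"; the tree's
`njl_twoPoint_clustering_prefactorFree` (`NJLTwoPointTransferOperatorClustering`) has `m > 0`.

1. `negSpin` — the algebra automorphism `σ_x ↦ -σ_x` of the real observables (any index set);
   `coeff_negSpin` (`coeff_d ∘ negSpin = (-1)^{|d|} coeff_d`), `negSpin_negSpin`, `negSpin_rename`.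
2. `negSpin_siteWeight/bondWeight/boltzmann`, **`bracket_neg_mass`**
   (`[Φ]_Λ(-m) = (-1)^{N|Λ|}[negSpin Φ]_Λ(m)`), **`expect_neg_mass`** (`⟨Φ⟩_Λ(-m) = ⟨negSpin Φ⟩_Λ(m)`)
   — for every complex spin system of the tree (any bond data `a`), every torus.
3. `njlState_neg_mass` (`⟨P⟩(-m) = ⟨negSpin P⟩(m)` in the infinite volume), `njlTwoPoint_neg_mass`
   (`T` even in `m`), `njlCondensate_neg_mass` (`s` odd in `m`).
4. **`njl_twoPoint_clustering_prefactorFree_of_ne_zero`** — Erratum (5) for EVERY real `m ≠ 0`: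
   `∃ κ(m) > 0, ∀ x ∈ ℤ^ν ∀ i, |⟨σ_0σ_x⟩ - ⟨σ_0⟩⟨σ_x⟩| ≤ e^{-κ(m)|x_i|}`; `_limit_of_ne_zero` in the
   finite-volume vocabulary (limits along any sequence of tori); `_supNorm` — verbatim with
   `|x| = max_i |x_i|`.

Faithfulness / scope.  The parity is an exact identity of the tree's polynomial model (no
analysis); (5) for `m < 0` is (5) for `-m > 0` transported by it.  β = 0 NJL / complex-spin
statements only; nothing about β > 0, the continuum or the summit's `QCD` conjunct.

## References

* M. Salmhofer, E. Seiler, *Proof of chiral symmetry breaking in strongly coupled lattice gauge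
  theory*, Commun. Math. Phys. 139 (1991) 395–432: §4 p. 420, Def. 3.1, Remark 3.2, (3.1)–(3.2).
  [SalmhoferSeiler1991]
* M. Salmhofer, E. Seiler, Erratum, Commun. Math. Phys. 146 (1992) 637–638: (5).
  [SalmhoferSeiler1992Erratum]
-/

noncomputable section

open Filter Topology MvPolynomial

namespace Literature.MathematicalPhysics.StatisticalMechanics

namespace ComplexSpin

open Literature.Probability.LatticeModels (TorusSite Site)
open Literature.Probability.LatticeModels

/-! ### The spin flip `σ_x ↦ -σ_x` on real observables -/

section NegSpin

variable {σ : Type*}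

/-- The spin flip `σ_x ↦ -σ_x` (all sites), an algebra automorphism of the real observables.
[cite: SalmhoferSeiler1991, §4 p. 420 ("without loss of generality `m ≥ 0`")] -/
def negSpin : MvPolynomial σ ℝ →ₐ[ℝ] MvPolynomial σ ℝ := aeval fun x => -X x

/-- `negSpin σ_x = -σ_x`. [cite: SalmhoferSeiler1991, §4 p. 420] -/
@[simp] theorem negSpin_X (x : σ) : negSpin (X x : MvPolynomial σ ℝ) = -X x := by
  simp [negSpin]

/-- `negSpin (c) = c`. [cite: SalmhoferSeiler1991, §4 p. 420] -/
@[simp] theorem negSpin_C (c : ℝ) : negSpin (C c : MvPolynomial σ ℝ) = C c :=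
  (negSpin (σ := σ)).commutes c

/-- The spin flip is an involution. [cite: SalmhoferSeiler1991, §4 p. 420] -/
theorem negSpin_negSpin (P : MvPolynomial σ ℝ) : negSpin (negSpin P) = P := by
  have h : (negSpin (σ := σ)).comp negSpin = AlgHom.id ℝ _ := by
    refine MvPolynomial.algHom_ext fun x => ?_
    simp
  exact DFunLike.congr_fun h P

/-- **The spin flip on coefficients**: `coeff_d (negSpin P) = (-1)^{|d|} coeff_d P`.
[cite: SalmhoferSeiler1991, §4 p. 420] -/
theorem coeff_negSpin (P : MvPolynomial σ ℝ) (d : σ →₀ ℕ) :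
    coeff d (negSpin P) = (-1) ^ d.degree * coeff d P := by
  classical
  induction P using MvPolynomial.induction_on generalizing d with
  | C a =>
    rw [negSpin_C, coeff_C]
    split_ifs with h
    · subst h; simp
    · rw [mul_zero]
  | add p q hp hq => rw [map_add, coeff_add, coeff_add, hp, hq, mul_add]
  | mul_X p x hp =>
    rw [map_mul, negSpin_X, mul_neg, coeff_neg, coeff_mul_X', coeff_mul_X']
    split_ifs with h
    · rw [hp]
      have hdeg : d.degree = (d - Finsupp.single x 1).degree + 1 := by
        have h1 : d = (d - Finsupp.single x 1) + Finsupp.single x 1 := by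
          ext y
          simp only [Finsupp.coe_add, Finsupp.coe_tsub, Pi.add_apply, Pi.sub_apply,
            Finsupp.single_apply]
          split_ifs with hxy
          · subst hxy
            have : 1 ≤ d x := Nat.one_le_iff_ne_zero.2 (Finsupp.mem_support_iff.1 h)
            omega
          · omega
        conv_lhs => rw [h1]
        rw [map_add, Finsupp.degree_single]
      rw [hdeg, pow_succ]
      ring
    · rw [neg_zero, mul_zero]

/-- `negSpin` commutes with reading observables on another index set (`rename`).
[cite: SalmhoferSeiler1991, §4 p. 420] -/
theorem negSpin_rename {τ : Type*} (f : σ → τ) (P : MvPolynomial σ ℝ) :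
    negSpin (rename f P) = rename f (negSpin P) := by
  have h : (negSpin (σ := τ)).comp (rename f) = (rename f).comp (negSpin (σ := σ)) := by
    refine MvPolynomial.algHom_ext fun x => ?_
    simp
  exact DFunLike.congr_fun h P

end NegSpin

/-! ### Mass parity of the finite-volume complex spin system -/

section Torus

variable {ν L : ℕ}

/-- `negSpin F_m(σ_x) = F_{-m}(σ_x)` for the site weight `∑_j (2Nm)^j σ_x^j / j!`.
[cite: SalmhoferSeiler1991, §4 p. 420 and Def. 3.1] -/
theorem negSpin_siteWeight (N : ℕ) (m : ℝ) (x : TorusSite ν L) :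
    negSpin (siteWeight N m x) = siteWeight N (-m) x := by
  simp only [siteWeight, map_sum, map_mul, negSpin_C, map_pow, negSpin_X]
  refine Finset.sum_congr rfl fun j _ => ?_
  have hC : ((-1 : MvPolynomial (TorusSite ν L) ℝ)) ^ j = C ((-1 : ℝ) ^ j) := by
    rw [map_pow, map_neg, map_one]
  have hs : (2 * N * m : ℝ) ^ j / (Nat.factorial j : ℝ) * (-1) ^ j =
      (2 * N * -m) ^ j / (Nat.factorial j : ℝ) := by
    rw [div_mul_eq_mul_div, ← mul_pow]
    congr 2
    ring
  rw [neg_pow, ← mul_assoc, hC, ← map_mul, hs]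

/-- The bond weight is even: `negSpin B(σ_xσ_y) = B(σ_xσ_y)`. [cite: SalmhoferSeiler1991, §4 p. 420 and Def. 3.1] -/
theorem negSpin_bondWeight (N : ℕ) (a : ℕ → ℝ) (x y : TorusSite ν L) :
    negSpin (bondWeight N a x y) = bondWeight N a x y := by
  simp only [bondWeight, map_sum, map_mul, negSpin_C, map_pow, negSpin_X, neg_mul_neg]

variable [NeZero L]

/-- `negSpin` maps the Boltzmann polynomial at mass `m` to the one at mass `-m`.
[cite: SalmhoferSeiler1991, §4 p. 420 and (3.1)] -/
theorem negSpin_boltzmann (N : ℕ) (m : ℝ) (a : ℕ → ℝ) :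
    negSpin (boltzmann (ν := ν) (L := L) N m a) = boltzmann N (-m) a := by
  simp only [boltzmann, map_mul, map_prod, negSpin_siteWeight, negSpin_bondWeight]

/-- **Mass parity of the bracket**: `[Φ]_Λ(-m) = (-1)^{N|Λ|} [negSpin Φ]_Λ(m)`.
[cite: SalmhoferSeiler1991, §4 p. 420 and (3.1)–(3.2)] -/
theorem bracket_neg_mass (N : ℕ) (m : ℝ) (a : ℕ → ℝ) (Φ : MvPolynomial (TorusSite ν L) ℝ) :
    bracket N (-m) a Φ = (-1) ^ (topExponent (ν := ν) (L := L) N).degree * bracket N m a (negSpin Φ) := by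
  rw [bracket, bracket, ← negSpin_boltzmann, ← coeff_negSpin]
  congr 1
  rw [map_mul, negSpin_negSpin]

/-- **Mass parity of the expectations**: `⟨Φ⟩_Λ(-m) = ⟨negSpin Φ⟩_Λ(m)` — "without loss of
generality `m ≥ 0`". [cite: SalmhoferSeiler1991, §4 p. 420 and (3.2)] -/
theorem expect_neg_mass (N : ℕ) (m : ℝ) (a : ℕ → ℝ) (Φ : MvPolynomial (TorusSite ν L) ℝ) :
    expect N (-m) a Φ = expect N m a (negSpin Φ) := by
  rw [expect_eq_div, expect_eq_div, partitionFunction, partitionFunction, bracket_neg_mass,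
    bracket_neg_mass, map_one, mul_div_mul_left _ _ (pow_ne_zero _ (by norm_num))]

end Torus

/-! ### Mass parity in the infinite volume and Erratum (5) for all real `m ≠ 0` -/

variable {ν : ℕ}

/-- **Mass parity of the infinite-volume NJL state**: `⟨P⟩(-m) = ⟨negSpin P⟩(m)`.
[cite: SalmhoferSeiler1991, §4 p. 420 and Thm. 3.8] -/
theorem njlState_neg_mass (N : ℕ) (m : ℝ) (P : MvPolynomial (Site ν) ℝ) :
    njlState N (-m) P = njlState N m (negSpin P) := by
  unfold njlState
  exact congrArg (limUnder atTop) (funext fun L => by rw [expect_neg_mass, negSpin_rename])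

/-- The two-point function is even in the mass: `T_{-m}(x) = T_m(x)`. [cite: SalmhoferSeiler1991, §4 p. 420] -/
theorem njlTwoPoint_neg_mass (N : ℕ) (m : ℝ) (x : Site ν) :
    njlTwoPoint N (-m) x = njlTwoPoint N m x := by
  rw [njlTwoPoint, njlTwoPoint, njlState_neg_mass, map_mul, negSpin_X, negSpin_X, neg_mul_neg]

/-- The condensate is odd in the mass: `s(-m) = -s(m)` (real `m ≠ 0`). [cite: SalmhoferSeiler1991, §4 p. 420] -/
theorem njlCondensate_neg_mass {N : ℕ} (hN : 1 ≤ N) (hν : 1 ≤ ν) {m : ℝ} (hm : m ≠ 0) :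
    njlCondensate ν N (-m) = -njlCondensate ν N m := by
  rw [njlCondensate, njlCondensate, njlState_neg_mass, negSpin_X,
    show (-X (0 : Site ν) : MvPolynomial (Site ν) ℝ) = (-1 : ℝ) • X 0 by simp,
    njlState_smul hN hν hm, neg_one_mul]

/-- **Erratum (5) for every real `m ≠ 0`** (both signs, by the mass parity): there is `κ(m) > 0`
with `|⟨σ_0σ_x⟩ - ⟨σ_0⟩⟨σ_x⟩| ≤ e^{-κ(m)|x_i|}` for all `x ∈ ℤ^ν` and all `i` — "For real `m ≠ 0`
and the two-point function we can get rid of `B₂(m)`". [cite: SalmhoferSeiler1992Erratum, (5)][cite: SalmhoferSeiler1991, §4 p. 420] -/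
theorem njl_twoPoint_clustering_prefactorFree_of_ne_zero {N : ℕ} (hN : 1 ≤ N) (hν : 1 ≤ ν) {m : ℝ}
    (hm : m ≠ 0) :
    ∃ κ : ℝ, 0 < κ ∧ ∀ (x : Site ν) (i : Fin ν),
      |njlTwoPoint N m x - njlCondensate ν N m ^ 2| ≤ Real.exp (-κ * |(x i : ℝ)|) := by
  rcases lt_or_gt_of_ne hm with hneg | hpos
  · have hm' : 0 < -m := by linarith
    obtain ⟨κ, hκ, h⟩ := njl_twoPoint_clustering_prefactorFree hN hν hm'
    refine ⟨κ, hκ, fun x i => ?_⟩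
    have h1 := h x i
    rwa [njlTwoPoint_neg_mass, njlCondensate_neg_mass hN hν hm, neg_sq] at h1
  · exact njl_twoPoint_clustering_prefactorFree hN hν hpos

/-- **Erratum (5) for every real `m ≠ 0`, in the finite-volume vocabulary**: the limits `T(x)`,
`s` along any sequence of tori exist and `|T(x) - s²| ≤ e^{-κ(m)|x_i|}`.
[cite: SalmhoferSeiler1992Erratum, (5)][cite: SalmhoferSeiler1991, Cor. 3.9] -/
theorem njl_twoPoint_clustering_prefactorFree_limit_of_ne_zero {N : ℕ} (hN : 1 ≤ N) (hν : 1 ≤ ν)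
    {m : ℝ} (hm : m ≠ 0) (Ls : ℕ → ℕ) [∀ n, NeZero (Ls n)] (hLs : Tendsto Ls atTop atTop) :
    ∃ T : Site ν → ℝ, ∃ s : ℝ,
      (∀ x : Site ν, Tendsto (fun n => expect (ν := ν) (L := Ls n) N m (njlBondCoeff N)
        (X 0 * X (Torus.proj (Ls n) x))) atTop (𝓝 (T x))) ∧
      (∀ x : Site ν, Tendsto (fun n => expect (ν := ν) (L := Ls n) N m (njlBondCoeff N)
        (X (Torus.proj (Ls n) x))) atTop (𝓝 s)) ∧
      ∃ κ : ℝ, 0 < κ ∧ ∀ (x : Site ν) (i : Fin ν), |T x - s ^ 2| ≤ Real.exp (-κ * |(x i : ℝ)|) := by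
  refine ⟨njlTwoPoint N m, njlCondensate ν N m, fun x => ?_, fun x => ?_,
    njl_twoPoint_clustering_prefactorFree_of_ne_zero hN hν hm⟩
  · have h := tendsto_njlState hN hν hm (X (0 : Site ν) * X x) Ls hLs
    simp_rw [rename_proj_X_mul_X] at h
    exact h
  · have h := tendsto_njlState hN hν hm (X x) Ls hLs
    simp_rw [rename_X] at h
    rw [← njlState_X N m x]
    exact h

/-- **Erratum (5) verbatim, with `|x| = max_i |x_i|`**: for every real `m ≠ 0` there is `κ(m) > 0`
with `|⟨σ_0σ_x⟩ - ⟨σ_0⟩⟨σ_x⟩| ≤ e^{-κ(m)|x|}` for all `x ∈ ℤ^ν`, `|x| = max{|x_i|}`.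
[cite: SalmhoferSeiler1992Erratum, (5)] -/
theorem njl_twoPoint_clustering_prefactorFree_supNorm {N : ℕ} (hN : 1 ≤ N) (hν : 1 ≤ ν) {m : ℝ}
    (hm : m ≠ 0) :
    ∃ κ : ℝ, 0 < κ ∧ ∀ x : Site ν,
      |njlTwoPoint N m x - njlCondensate ν N m ^ 2| ≤
        Real.exp (-κ * ((Finset.univ.sup fun i : Fin ν => (x i).natAbs : ℕ) : ℝ)) := by
  obtain ⟨κ, hκ, h⟩ := njl_twoPoint_clustering_prefactorFree_of_ne_zero hN hν hm
  refine ⟨κ, hκ, fun x => ?_⟩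
  haveI : Nonempty (Fin ν) := ⟨⟨0, by omega⟩⟩
  obtain ⟨i, -, hi⟩ := Finset.exists_mem_eq_sup (Finset.univ : Finset (Fin ν)) Finset.univ_nonempty
    fun j : Fin ν => (x j).natAbs
  rw [hi]
  refine (h x i).trans_eq ?_
  rw [Nat.cast_natAbs, Int.cast_abs]

end ComplexSpin

end Literature.MathematicalPhysics.StatisticalMechanics

end
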